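import Literature.Computability.QuantumComplexity.RevUncomputeUniform
import HarnessLib

/-!
# The description of a garbage-free block is polynomial time

Trunk `CryptoQuantFine`; the assembly, promised at the end of `RevUncomputeUniform.lean`, of its
generators into one statement: for a polynomial-time machine `M` (exponent `e`), a data length
`n₀(u)` and a tableau length `N(u) = n₀(u) + |v(u)|` given by counter expressions in the family
index `u` (`InUU`), and a constant suffix `v(u)` whose `1`s form runs described by segments
`(start, length)` (again expressions in `u`), **the description bits of the clean block
`RevClean.cleanOps e M (n₀ u) (v u)` — the concatenation of the `opBits` of its gates, i.e. the
`QCircuit.encode` contribution of its exact Clifford+T compilation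
(`RevDesc.flatMap_gateEnc_revCompile_toRevList`) — are a polynomial-time function of `1ᵘ`**
(`RevClean.flatMap_opBits_cleanOps_mem_FP`). The block is `notsV ++ comp ++ outOps ++
reverse comp ++ notsV`: the three forward pieces are rendered from one generator
(`notsSegG`, `compGW opsG`, `outGW opsG`, `GStmt.render_out_mem_FP`), the reversed tableau from
the back-to-front generator `compGW opsGR` followed by string reversal
(`render_reverse_out_mem_FP`, `reverse_out_compGR`), the last `notsV` again from `notsSegG`,
and the pieces are concatenated (`append_mem_FP`). This is the uniformity half of "classical
subroutines inside a uniform quantum circuit family are free" (Bernstein–Vazirani 1997, §8;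
Shor 1997, §2 p. 7: "the design of the gate array be produced by a polynomial-time (classical)
computation"; Arora–Barak 2009, Remark 6.7).

## References

* S. Arora, B. Barak, *Computational Complexity: A Modern Approach*, CUP 2009, §6.2 and proof
  of Thm. 6.15, Remark 6.7, §1.3.
* P. W. Shor, SIAM J. Comput. 26 (1997), §2 p. 7, §3 p. 8.
* E. Bernstein, U. Vazirani, *Quantum complexity theory*, SIAM J. Comput. 26 (1997), §8.
-/

noncomputable section

namespace Literature.Computability.QuantumComplexity

namespace RevClean

open _root_.Computability Complexity Turing RevDesc RevSim

variable (e : ℕ) (M : TM2ComputableAux Bool Bool)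

/-- The environment of the family index `u`. [folklore] -/
abbrev envU (u : ℕ) : GV → ℕ := GenProg.initEnv GV.uu u

/-- **The forward generator of a clean block**: suffix `NOT`s, compute half, read-out.
[cite: Shor1997, §3 p.8 (compute F(x) keeping x, copy, undo)] -/
def fwdG (NE : GE) (segs : List (GE × GE)) : GS :=
  seqs [notsSegG segs, compGW e M opsG NE, outGW e M opsG NE]

variable {e M}

/-- An expression in `uu` does not mention `jj`. [folklore] -/
theorem jj_notMem_fv_of_inUU {E : GE} (h : InUU E) : GV.jj ∉ E.fv := fun hm => absurd (h _ hm) (by decide)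

/-- Rendering a pure program-token stream gives the program description. [folklore] -/
theorem render_flatMap_opToks_nil (ops : List (ClOp ℕ)) : Tok.render 0 (ops.flatMap opToks) = ops.flatMap opBits := by
  have h := render_flatMap_opToks ops []
  rwa [List.append_nil, Tok.render_nil, List.append_nil] at h

/-- **The forward generator prints `notsV ++ comp ++ outOps`.** [folklore] -/
theorem out_fwdG {NE : GE} (hNE : InUU NE) {segs : List (GE × GE)} (hsegs : ∀ p ∈ segs, InUU p.1)
    (env : GV → ℕ) :
    (fwdG e M NE segs).out env =
      ((segs.flatMap fun p => (List.range (p.2.eval env)).map fun i => ClOp.not (p.1.eval env + i)) ++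
        (comp e M (NE.eval env) ++ outOps e M (NE.eval env))).flatMap opToks := by
  rw [fwdG, out_seqs]
  simp only [List.flatMap_cons, List.flatMap_nil, List.append_nil, List.flatMap_append]
  rw [out_notsSegG segs (fun p hp => jj_notMem_fv_of_inUU (hsegs p hp)), out_compG hNE,
    out_outGW opToks out_opsG loopVars_opsG_sub hNE]

/-- Loop variables of the forward generator. [folklore] -/
theorem uu_notMem_loopVars_fwdG (NE : GE) (segs : List (GE × GE)) : GV.uu ∉ (fwdG e M NE segs).loopVars := by
  intro h
  rw [fwdG, loopVars_seqs] at h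
  simp only [List.flatMap_cons, List.flatMap_nil, List.append_nil, List.mem_append] at h
  rcases h with h | h | h
  · rcases loopVars_notsSegG_sub segs _ h with h | h | h <;> exact absurd h (by decide)
  · rcases loopVars_compGW_sub loopVars_opsG_sub NE _ h with h | h | h <;> exact absurd h (by decide)
  · rcases loopVars_outGW_sub loopVars_opsG_sub NE _ h with h | h | h <;> exact absurd h (by decide)

/-- Non-reuse of the forward generator. [folklore] -/
theorem noReuse_fwdG (NE : GE) (segs : List (GE × GE)) : (fwdG e M NE segs).noReuse = true := by
  rw [fwdG]
  exact noReuse_seqs _ fun s hs => by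
    simp only [List.mem_cons, List.not_mem_nil, or_false] at hs
    rcases hs with rfl | rfl | rfl
    · exact noReuse_notsSegG segs
    · exact noReuse_compGW loopVars_opsG_sub noReuse_opsG NE
    · exact noReuse_outGW loopVars_opsG_sub noReuse_opsG NE

/-- Loop variables of the backward compute generator. [folklore] -/
theorem uu_notMem_loopVars_compGR (NE : GE) : GV.uu ∉ (compGW e M opsGR NE).loopVars := fun h => by
  rcases loopVars_compGW_sub loopVars_opsGR_sub NE _ h with h | h | h <;> exact absurd h (by decide)

/-- Loop variables of the suffix generator. [folklore] -/
theorem uu_notMem_loopVars_notsSegG (segs : List (GE × GE)) : GV.uu ∉ (notsSegG segs).loopVars := fun h => by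
  rcases loopVars_notsSegG_sub segs _ h with h | h | h <;> exact absurd h (by decide)

/-- **The description of a clean block is polynomial time.** For a data length `n₀(u)` and a
tableau length `N(u)` given by expressions in the family index, and a suffix `v(u)` with
`N(u) = n₀(u) + |v(u)|` whose suffix gadget `notsV` consists of the runs described by `segs`,
the map `1ᵘ ↦ (cleanOps e M (n₀ u) (v u)).flatMap opBits` is in `FP`.
[cite: AroraBarak2009, §6.2 Def. 6.12 and Remark 6.7 (descriptions printed in polynomial time)] -/
theorem flatMap_opBits_cleanOps_mem_FP (n0E NE : GE) (segs : List (GE × GE)) (hNE : InUU NE)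
    (hsegs : ∀ p ∈ segs, InUU p.1) (v : ℕ → List Bool)
    (hv : ∀ u, notsV (n0E.eval (envU u)) (v u) =
      segs.flatMap fun p => (List.range (p.2.eval (envU u))).map fun i => ClOp.not (p.1.eval (envU u) + i))
    (hN : ∀ u, NE.eval (envU u) = n0E.eval (envU u) + (v u).length) :
    (fun z : List Bool => (cleanOps e M (n0E.eval (envU z.length)) (v z.length)).flatMap opBits) ∈ FP := by
  -- the three FP pieces
  have h1 := GStmt.render_out_mem_FP (fwdG e M NE segs) GV.uu (uu_notMem_loopVars_fwdG NE segs) (noReuse_fwdG NE segs)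
  have h2 := render_reverse_out_mem_FP (compGW e M opsGR NE) GV.uu (uu_notMem_loopVars_compGR NE)
    (noReuse_compGW loopVars_opsGR_sub noReuse_opsGR NE)
  have h3 := GStmt.render_out_mem_FP (notsSegG segs) GV.uu (uu_notMem_loopVars_notsSegG segs) (noReuse_notsSegG segs)
  have h := append_mem_FP h1 (append_mem_FP h2 h3)
  refine (congrArg (· ∈ FP) (funext fun z => ?_)).mpr h
  -- the stream identities
  set u := z.length
  have e1 : Tok.render 0 ((fwdG e M NE segs).out (GenProg.initEnv GV.uu u)) =
      (notsV (n0E.eval (envU u)) (v u) ++ (comp e M (NE.eval (envU u)) ++ outOps e M (NE.eval (envU u)))).flatMap opBits := by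
    rw [out_fwdG hNE hsegs, render_flatMap_opToks_nil, ← hv u]
  have e2 : Tok.render 0 ((compGW e M opsGR NE).out (GenProg.initEnv GV.uu u)).reverse =
      (comp e M (NE.eval (envU u))).reverse.flatMap opBits := by
    rw [show GenProg.initEnv GV.uu u = envU u from rfl, reverse_out_compGR hNE, render_flatMap_opToks_nil]
  have e3 : Tok.render 0 ((notsSegG segs).out (GenProg.initEnv GV.uu u)) = (notsV (n0E.eval (envU u)) (v u)).flatMap opBits := by
    rw [out_notsSegG segs (fun p hp => jj_notMem_fv_of_inUU (hsegs p hp)), render_flatMap_opToks_nil,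
      show GenProg.initEnv GV.uu u = envU u from rfl, ← hv u]
  change _ = Tok.render 0 ((fwdG e M NE segs).out (GenProg.initEnv GV.uu u)) ++
    (Tok.render 0 ((compGW e M opsGR NE).out (GenProg.initEnv GV.uu u)).reverse ++
      Tok.render 0 ((notsSegG segs).out (GenProg.initEnv GV.uu u)))
  rw [e1, e2, e3, cleanOps, hN u]
  simp only [List.flatMap_append, List.append_assoc]

end RevClean

end Literature.Computability.QuantumComplexity

end
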